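import Mathlib
import HarnessLib

/-!
# Magnen–Rivasseau–Sénéor, *Construction of YM₄ with an infrared cutoff* (CMP 155, 1993), §V.E–V.F — the two determinant
# inequalities the expansion «recalls»: (V.14) `det₄(1 + K) ≤ det(1 + K) e^{Tr(−K + K²/2 − K³/3 + K⁴/4)}` and (V.15)
# `|det(1 + K)| ≤ e^{(1/2)Tr(K + K* + KK*)}`, PROVED for finite real matrices (with the hypothesis (V.14) needs made explicit)

statement-level skeleton of published theorems with citation tags; proofs where landed; nothing here is a claim about the
Yang–Mills mass gap, about continuum YM₄ on T⁴, or about the Clay problem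

**Citation header (reproduction of PUBLISHED work).** J. Magnen, V. Rivasseau, R. Sénéor, *Construction of YM₄ with an infrared
cutoff*, Commun. Math. Phys. **155** (1993) 325–383 [MagnenRivasseauSeneor1993], Sect. V.E p.366 and V.F p.367. Loci «p.NNN [PDF nn]
tl.k» = journal page, PDF page (= journal page − 324), text-layer line of the held Project-Euclid scan
`paper:magnen1993-cmp155-mrs-ym4-infrared-cutoff` (PDF sha256 fa4ddac3…); (V.14)/(V.15) read on the page images
`run/shared/lean/pub/lit-balaban/inprint/lit-balaban-p14/renders-cmp155/p42_full_s6.png`, `p43_full_s6.png`. Cell pub-balaban-gaps (YM blitz,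
track G3), seat mrs-lit-2; companion record `run/shared/lean/pub/pub-balaban-gaps/g3/MRS-AS-PRINTED-estimates.md`.

**What the paper prints (verbatim; displays from the page images).**
* p.366 [PDF 42] tl.18–22: «One could believe that the not-cancelled counterterms together with the determinants simply form subtracted
  determinants of the det₄ type. We recall that `det₄(1 + K) ≤ det(1 + K) e^{Tr −K + K²/2 − K³/3 + K⁴/4}`. (V.14) But to our surprise
  this turned out not to be true. The non-dominable part of the Fadeev-Popov determinant plus the corresponding uncancelled counterterms
  gives indeed a det₄.»
* p.367 [PDF 43] tl.17–21: «– if p₀ or p⃗ are small, we can use a rough bound such as `|det(1 + K)| ≤ e^{(1/2)Tr(K + K* + K·K*)}`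
  (V.15) on the corresponding determinants; since the corresponding momentum integrals are unbounded either in three or one dimensions,
  the resulting bound in λ²B² is either linearly divergent or convergent.»

**What is proved here (zero `sorry`, zero named facts), for real `n × n` matrices** (the finite-dimensional content of the two recalled
inequalities; the paper applies them to cut-off operators, i.e. after its own finite-dimensional/trace-class reduction, which is not
formalised):
* §1 `det_le_exp_trace_sub_card` — for a positive semidefinite real symmetric `P`: `det P ≤ exp(Tr P − n)` (eigenvalues `μᵢ ≥ 0`,
  `μ ≤ e^{μ−1}`). [folklore: the AM–GM / `1 + x ≤ eˣ` step behind every `det ≤ e^{Tr}` bound.]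
* §2 **(V.15)** `abs_det_one_add_le_exp` — `|det(1 + K)| ≤ exp(½ Tr(K + Kᵀ + KKᵀ))` for EVERY real square `K` (real case of the print's
  `K*`): `|det(1+K)|² = det((1+K)(1+K)ᵀ)`, `(1+K)(1+K)ᵀ = 1 + K + Kᵀ + KKᵀ` is positive semidefinite, then §1.
* §3 **(V.14)** `det4` — the regularised determinant `det₄(1 + K) := det(1 + K)·exp(Tr(−K + K²/2 − K³/3))` (its standard definition,
  [folklore]); `trace_pow_four_nonneg` — `Tr K⁴ ≥ 0` for symmetric `K`; `det4_le_printed` — (V.14) for SYMMETRIC `K` with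
  `det(1 + K) ≥ 0` (e.g. `1 + K ≥ 0`, the case of normalised Gaussian covariances): then the printed right side is `det₄(1+K)·e^{Tr K⁴/4}
  ≥ det₄(1+K)`. PRECISION (ours): the sign hypothesis is NEEDED for the inequality as printed — `det4_printed_needs_sign`: the `1 × 1`
  matrix `K = −2` gives `det₄(1+K) = −e^{20/3} > −e^{32/3} =` the printed right side. (The paper's «We recall that» is the customary
  loose citation of the `det_n` bounds, cf. Simon, *Trace ideals*, Thm 9.2: `|det_n(1 + A)| ≤ exp(Γ_n‖A‖_nⁿ)`; nothing in its argument
  depends on the loose form, which it immediately says does NOT describe its situation — «this turned out not to be true».)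

**Readings (declared).** (i) Real matrices, `K* = Kᵀ`; the complex/Hermitian case is the same argument with `ᴴ`. (ii) «Tr −K + K²/2 −
K³/3 + K⁴/4» = the trace of the polynomial `−K + K²/2 − K³/3 + K⁴/4`. (iii) `det₄` is typed by its definition, which the paper does not
restate.

**What is NOT claimed.** Infinite-dimensional (trace-class / Hilbert–Schmidt) determinants, the operators `K` of Sects. V–VI, the «det₄
surprise» itself (a statement about MRS's counterterms, pp.366–367), anything of Sect. VI. Nothing here bears on Bałaban's papers.
-/

noncomputable section

open Real Matrix Finset

namespace Literature.MathematicalPhysics.QuantumFieldTheory.MagnenRivasseauSeneor1993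

namespace Determinants

variable {n : Type*} [Fintype n] [DecidableEq n]

/-! ## §1 `det P ≤ exp(Tr P − n)` for positive semidefinite `P` -/

/-- For a positive semidefinite real symmetric matrix `P`: `det P ≤ exp(Tr P − n)` — with eigenvalues `μᵢ ≥ 0`,
`det P = ∏ μᵢ ≤ ∏ e^{μᵢ − 1} = e^{Tr P − n}`. [folklore] -/
private theorem det_le_exp_trace_sub_card {P : Matrix n n ℝ} (hP : P.PosSemidef) :
    P.det ≤ Real.exp (P.trace - Fintype.card n) := by
  have hH : P.IsHermitian := hP.1
  rw [hH.det_eq_prod_eigenvalues, hH.trace_eq_sum_eigenvalues]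
  simp only [RCLike.ofReal_real_eq_id, id_eq]
  have hnn : ∀ i, 0 ≤ hH.eigenvalues i := fun i => hP.eigenvalues_nonneg i
  calc ∏ i, hH.eigenvalues i ≤ ∏ i, Real.exp (hH.eigenvalues i - 1) := by
        refine Finset.prod_le_prod (fun i _ => hnn i) (fun i _ => ?_)
        linarith [Real.add_one_le_exp (hH.eigenvalues i - 1)]
    _ = Real.exp (∑ i, (hH.eigenvalues i - 1)) := by rw [Real.exp_sum]
    _ = Real.exp (∑ i, hH.eigenvalues i - Fintype.card n) := by
        congr 1
        rw [Finset.sum_sub_distrib]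
        simp

/-! ## §2 (V.15) -/

/-- **(V.15)** p.367 [PDF 43] tl.17–18, verbatim: «we can use a rough bound such as `|det(1 + K)| ≤ e^{(1/2)Tr(K + K* + K·K*)}` (V.15)»
— proved for every real square matrix `K` (`K* = Kᵀ`): `|det(1 + K)|² = det((1 + K)(1 + K)ᵀ)`, and `(1 + K)(1 + K)ᵀ = 1 + (K + Kᵀ + KKᵀ)`
is positive semidefinite, so its determinant is `≤ exp(Tr(K + Kᵀ + KKᵀ))` (§1). [cite: MagnenRivasseauSeneor1993, §V.F (V.15) p.367] -/
theorem abs_det_one_add_le_exp (K : Matrix n n ℝ) :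
    |(1 + K).det| ≤ Real.exp (1 / 2 * (K + Kᵀ + K * Kᵀ).trace) := by
  set P : Matrix n n ℝ := (1 + K) * (1 + K)ᵀ with hPdef
  have hP : P.PosSemidef := by
    have h := Matrix.posSemidef_self_mul_conjTranspose (1 + K)
    rwa [Matrix.conjTranspose_eq_transpose_of_trivial] at h
  have hdet : P.det = (1 + K).det ^ 2 := by
    rw [hPdef, Matrix.det_mul, Matrix.det_transpose, sq]
  have htr : P.trace = Fintype.card n + (K + Kᵀ + K * Kᵀ).trace := by
    have hexp : P = 1 + (K + Kᵀ + K * Kᵀ) := by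
      rw [hPdef, Matrix.transpose_add, Matrix.transpose_one]
      noncomm_ring
    rw [hexp, Matrix.trace_add, Matrix.trace_one]
  have hcore := det_le_exp_trace_sub_card hP
  rw [hdet, htr] at hcore
  have hsq : (1 + K).det ^ 2 ≤ Real.exp ((K + Kᵀ + K * Kᵀ).trace) := by
    have : (Fintype.card n : ℝ) + (K + Kᵀ + K * Kᵀ).trace - Fintype.card n = (K + Kᵀ + K * Kᵀ).trace := by ring
    rwa [this] at hcore
  calc |(1 + K).det| ≤ √(Real.exp ((K + Kᵀ + K * Kᵀ).trace)) := Real.abs_le_sqrt hsq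
    _ = Real.exp (1 / 2 * (K + Kᵀ + K * Kᵀ).trace) := by
        rw [← Real.exp_half]
        congr 1
        ring

/-! ## §3 (V.14) -/

/-- The regularised determinant `det₄(1 + K) := det(1 + K)·exp(Tr(−K + K²/2 − K³/3))` (finite real matrices; the definition the paper's
«subtracted determinants of the det₄ type», p.366 tl.19, refers to). [folklore] -/
def det4 (K : Matrix n n ℝ) : ℝ :=
  (1 + K).det * Real.exp ((-K + (1 / 2 : ℝ) • K ^ 2 - (1 / 3 : ℝ) • K ^ 3).trace)

/-- For a real SYMMETRIC `K`, `Tr K⁴ ≥ 0` (`K⁴ = (K²)ᵀ(K²)` is positive semidefinite).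
[cite: MagnenRivasseauSeneor1993, §V.E (V.14) p.366] -/
theorem trace_pow_four_nonneg {K : Matrix n n ℝ} (hK : K.IsSymm) : 0 ≤ (K ^ 4).trace := by
  have hsq : (K ^ 2)ᴴ = K ^ 2 := by
    rw [Matrix.conjTranspose_eq_transpose_of_trivial, Matrix.transpose_pow, hK.eq]
  have h := Matrix.posSemidef_conjTranspose_mul_self (K ^ 2)
  rw [hsq, ← pow_add] at h
  exact h.trace_nonneg

/-- **(V.14)** p.366 [PDF 42] tl.19–21, verbatim: «We recall that `det₄(1 + K) ≤ det(1 + K) e^{Tr −K + K²/2 − K³/3 + K⁴/4}`. (V.14)» —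
proved for real SYMMETRIC `K` with `det(1 + K) ≥ 0` (e.g. `1 + K` positive semidefinite): the printed right side equals
`det₄(1 + K)·e^{Tr K⁴/4}` and `Tr K⁴ ≥ 0`. The sign hypothesis is necessary for the inequality as printed (`det4_printed_needs_sign`).
[cite: MagnenRivasseauSeneor1993, §V.E (V.14) p.366] -/
theorem det4_le_printed {K : Matrix n n ℝ} (hK : K.IsSymm) (hdet : 0 ≤ (1 + K).det) :
    det4 K ≤ (1 + K).det * Real.exp ((-K + (1 / 2 : ℝ) • K ^ 2 - (1 / 3 : ℝ) • K ^ 3 + (1 / 4 : ℝ) • K ^ 4).trace) := by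
  unfold det4
  refine mul_le_mul_of_nonneg_left (Real.exp_le_exp.2 ?_) hdet
  rw [Matrix.trace_add (-K + (1 / 2 : ℝ) • K ^ 2 - (1 / 3 : ℝ) • K ^ 3), Matrix.trace_smul, smul_eq_mul]
  have h4 := trace_pow_four_nonneg hK
  nlinarith

/-- PRECISION (ours, kernel-checked): without `det(1 + K) ≥ 0` the display (V.14) read literally fails — for the `1 × 1` matrix
`K = −2`: `det(1 + K) = −1`, `det₄(1 + K) = −e^{2 + 2 + 8/3} = −e^{20/3}`, printed right side `= −e^{20/3 + 4} < det₄(1 + K)`.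
[cite: MagnenRivasseauSeneor1993, §V.E (V.14) p.366] -/
theorem det4_printed_needs_sign :
    ∃ K : Matrix (Fin 1) (Fin 1) ℝ, K.IsSymm ∧
      ¬ (det4 K ≤ (1 + K).det * Real.exp ((-K + (1 / 2 : ℝ) • K ^ 2 - (1 / 3 : ℝ) • K ^ 3 + (1 / 4 : ℝ) • K ^ 4).trace)) := by
  refine ⟨(-2 : ℝ) • (1 : Matrix (Fin 1) (Fin 1) ℝ), ?_, ?_⟩
  · exact (Matrix.isSymm_one).smul (-2 : ℝ)
  · unfold det4
    have hdet : (1 + (-2 : ℝ) • (1 : Matrix (Fin 1) (Fin 1) ℝ)).det = -1 := by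
      rw [show (1 : Matrix (Fin 1) (Fin 1) ℝ) + (-2 : ℝ) • (1 : Matrix (Fin 1) (Fin 1) ℝ) =
          (-1 : ℝ) • (1 : Matrix (Fin 1) (Fin 1) ℝ) by
            rw [← one_smul ℝ (1 : Matrix (Fin 1) (Fin 1) ℝ), smul_smul, ← add_smul]; norm_num]
      rw [Matrix.det_smul, Matrix.det_one]
      simp
    have htr3 : (-((-2 : ℝ) • (1 : Matrix (Fin 1) (Fin 1) ℝ)) + (1 / 2 : ℝ) • ((-2 : ℝ) • (1 : Matrix (Fin 1) (Fin 1) ℝ)) ^ 2 -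
        (1 / 3 : ℝ) • ((-2 : ℝ) • (1 : Matrix (Fin 1) (Fin 1) ℝ)) ^ 3).trace = 20 / 3 := by
      simp only [smul_pow, one_pow, Matrix.trace_sub, Matrix.trace_add, Matrix.trace_neg, Matrix.trace_smul,
        Matrix.trace_one, Fintype.card_fin, smul_eq_mul]
      norm_num
    have htr4 : (-((-2 : ℝ) • (1 : Matrix (Fin 1) (Fin 1) ℝ)) + (1 / 2 : ℝ) • ((-2 : ℝ) • (1 : Matrix (Fin 1) (Fin 1) ℝ)) ^ 2 -
        (1 / 3 : ℝ) • ((-2 : ℝ) • (1 : Matrix (Fin 1) (Fin 1) ℝ)) ^ 3 +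
        (1 / 4 : ℝ) • ((-2 : ℝ) • (1 : Matrix (Fin 1) (Fin 1) ℝ)) ^ 4).trace = 20 / 3 + 4 := by
      simp only [smul_pow, one_pow, Matrix.trace_sub, Matrix.trace_add, Matrix.trace_neg, Matrix.trace_smul,
        Matrix.trace_one, Fintype.card_fin, smul_eq_mul]
      norm_num
    rw [hdet, htr3, htr4, not_le]
    have : Real.exp (20 / 3) < Real.exp (20 / 3 + 4) := Real.exp_lt_exp.2 (by norm_num)
    linarith

end Determinants

end Literature.MathematicalPhysics.QuantumFieldTheory.MagnenRivasseauSeneor1993
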